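import Mathlib
import Literature.AlgebraicGeometry.Resolution.RegularLocalRingsNormal
import Literature.AlgebraicGeometry.Resolution.RegularLocalRingsQuotient
import Literature.RingTheory.KrullDimension.AffineDimension
import Summits.ResolutionOfSingularities.ResolutionOfSingularities.Theorems.RadicialJungCleanModelsSufficeRegularTypeSop
import Literature.AlgebraicGeometry.Resolution.KummerDescentRootOverring

/-!
# Route `RadicialJung`, crux `CleanModelsSuffice` (stmt-ResolutionOfSingularities-15883), line `Sketch`, skeleton v3:
# stub `stub_kummerDescent`

Registered stub `stub_kummerDescent` of the skeleton of
`Summit.ResolutionOfSingularities.ResolutionOfSingularities.Theses.RadicialJung.CleanModelsSuffice`: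
the ring-level heart of the normality of the Kummer order over a regular local ring. Let `A` be a
regular local ring with fraction field `K` of characteristic `p`, `t_0, …, t_m ∈ A` such that the
`t_i ∈ 𝔪_A` ("charged", index set `S ∋ i₀`) are, without repetition, members of a minimal system of
generators `tw` of `𝔪_A` and the other `t_i` are units, `p ∤ a_i`, `g = ∏ t_i^{a_i}`. If
`κ_0, …, κ_{p-1} ∈ K` satisfy `Σ_j κ_j^p g^j ∈ A`, then `κ_j ∏_i t_i^{⌊j a_i/p⌋} ∈ A` for all `j`.
The two hypotheses `hPI`, `hRO` are the statements of the sibling stubs `stub_pIndep`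
(`p`-independence of regular parameters) and `stub_rootOverring` (the `p`-th root overring
`A[τ]` of a regular local ring is regular, hence integrally closed, and spanned by the monomials).

## Proof (reduction to `Literature.AlgebraicGeometry.Resolution.kummerDescent_of_rootOverring`)

* Unit part: `g = u · ∏_{i ∈ S} t_i^{a_i}` with `u = ∏_{i ∉ S} t_i^{a_i} ∈ Aˣ`. Choose `b, c'` with
  `a_{i₀} b = p c' + 1` (`p ∤ a_{i₀}`), put `W = u^b` and twist the generator `tw (ι i₀) = t_{i₀}`
  to `t_{i₀} W` (`tw'`; still a minimal system of generators, `span_range_update_mul_unit`).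
  Enumerating `S` by `enum : Fin s ≃ S` gives `ι' = ι ∘ enum : Fin s ↪ Fin d` and, for every
  exponent function `f`, `∏_k tw'(ι' k)^{f(enum k)} = (∏_{i∈S} t_i^{f i}) · W^{f i₀}`
  (`prod_pow_twist_reindex`).
  With `f = j·a`: `∏_k tw'(ι' k)^{j a_k} = u^{p c' j} g^j`, so `Σ_j κ_j^p g^j = Σ_j (κ_j u^{-c' j})^p ∏_k tw'(ι' k)^{j a_k}`.
* In `Ω = K̄` pick `τ_k` with `τ_k^p = tw' (ι' k)`; `hRO` makes `A[τ]` integrally closed and spanned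
  by the monomials, `hPI` makes the `tw' (ι' k)` `p`-independent; the exponent vectors
  `(j a_{enum k})_k` have distinct reductions mod `p` (coordinate `i₀`, `a_{i₀}` invertible mod `p`).
  The abstract descent gives `κ_j u^{-c' j} ∏_k tw'(ι' k)^{⌊j a_k/p⌋} ∈ A`.
* Untwist with `f = ⌊j·a/p⌋`: `∏_i t_i^{⌊j a_i/p⌋}` differs from `∏_k tw'(ι' k)^{⌊j a_k/p⌋}` by the
  factor `(∏_{i∉S} t_i^{⌊j a_i/p⌋}) · W^{-⌊j a_{i₀}/p⌋} ∈ A`.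

Sources: folklore (Kummer theory in the parameters of a regular local ring; this chain replaces
Kato 1994 (4.1) in the line); the abstract descent and the independence of the root monomials
over `K` are `Literature/AlgebraicGeometry/Resolution/KummerDescentRootOverring.lean`. Not here:
the sibling stubs themselves (taken as hypotheses), and the passage from this statement to
`IsIntegrallyClosed` of the Kummer order (`stub_kummerNormal`).
-/

noncomputable section

set_option linter.dupNamespace false -- mandated namespace of this single-conjunct summit

open IsLocalRing
open Literature.AlgebraicGeometry.Resolution

namespace Summit.ResolutionOfSingularities.ResolutionOfSingularities.Theorems.RadicialJung.CleanModelsSuffice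

/-- STUB (Kummer descent of integral elements, ring level, from `stub_pIndep` and `stub_rootOverring`).
Let `A` be a regular local ring with fraction field `K` of characteristic `p`, `t₀ … t_m ∈ A ∖ 0` such that
those lying in `𝔪_A` are (jointly, without repetition) part of a minimal system of generators of `𝔪_A`
and at least one does, `a_i` prime to `p`, `g = ∏ t_i^{a_i}`. If `κ₀ … κ_{p-1} ∈ K` satisfy
`Σ_j κ_j^p g^j ∈ A`, then `κ_j · ∏_i t_i^{⌊j a_i/p⌋} ∈ A` for every `j`. (In `Ω = K̄` put `τ_i^p = t_i'`
for the charged parameters with the unit part of `g` absorbed, `β = unit · ∏ τ_i^{a_i}`, `β^p = g`;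
`X = Σ κ_j β^j` has `X^p ∈ A`, so `X ∈ A[τ]` by `stub_rootOverring`; compare coefficients on the monomials
`τ^e`, independent over `K` by `stub_pIndep`.) [folklore] -/
theorem stub_kummerDescent
    (hPI : ∀ {A : Type} [CommRing A] [IsRegularLocalRing A] (p : ℕ) (_ : p.Prime) [CharP A p]
      (s d : ℕ) (tw : Fin d → A) (_ : Ideal.span (Set.range tw) = maximalIdeal A)
      (_ : ringKrullDim A = (d : WithBot ℕ∞)) (ι : Fin s → Fin d) (_ : Function.Injective ι)
      (c : (Fin s → Fin p) → A)
      (_ : ∑ e : Fin s → Fin p, c e ^ p * ∏ i : Fin s, tw (ι i) ^ (e i : ℕ) = 0),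
      ∀ e, c e = 0)
    (hRO : ∀ {A Ω : Type} [CommRing A] [IsRegularLocalRing A] [Field Ω] [Algebra A Ω]
      (_ : Function.Injective (algebraMap A Ω)) (p : ℕ) (_ : p.Prime) [CharP A p]
      (s d : ℕ) (tw : Fin d → A) (_ : Ideal.span (Set.range tw) = maximalIdeal A)
      (_ : ringKrullDim A = (d : WithBot ℕ∞)) (ι : Fin s → Fin d) (_ : Function.Injective ι)
      (τ : Fin s → Ω) (_ : ∀ i, τ i ^ p = algebraMap A Ω (tw (ι i))),
      IsRegularLocalRing (Algebra.adjoin A (Set.range τ)) ∧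
        IsIntegrallyClosed (Algebra.adjoin A (Set.range τ)) ∧
        Module.Finite A (Algebra.adjoin A (Set.range τ)) ∧
        Subalgebra.toSubmodule (Algebra.adjoin A (Set.range τ)) =
          Submodule.span A (Set.range fun e : Fin s → Fin p => ∏ i, τ i ^ (e i : ℕ)))
    {A K : Type} [CommRing A] [IsRegularLocalRing A] [Field K] [Algebra A K] [IsFractionRing A K]
    (p : ℕ) (hp : p.Prime) [CharP K p] (m : ℕ) (t : Fin (m + 1) → A) (ht : ∀ i, t i ≠ 0)
    (a : Fin (m + 1) → ℕ) (ha : ∀ i, ¬ p ∣ a i) (hSne : ∃ i, t i ∈ maximalIdeal A)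
    (hsop : ∃ (d : ℕ) (tw : Fin d → A) (ι : Fin (m + 1) → Fin d),
      Ideal.span (Set.range tw) = maximalIdeal A ∧ ringKrullDim A = (d : WithBot ℕ∞) ∧
      (∀ i, t i ∈ maximalIdeal A → tw (ι i) = t i) ∧
      (∀ i j, t i ∈ maximalIdeal A → t j ∈ maximalIdeal A → ι i = ι j → i = j))
    (κ : Fin p → K)
    (hκ : ∑ j : Fin p, κ j ^ p * algebraMap A K (∏ i, t i ^ a i) ^ (j : ℕ) ∈ (algebraMap A K).range) :
    ∀ j : Fin p, κ j * algebraMap A K (∏ i, t i ^ ((j : ℕ) * a i / p)) ∈ (algebraMap A K).range := by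
  classical
  have _ := ht -- (`t i ≠ 0` is not needed: the `t i` are units or minimal generators of `𝔪`)
  obtain ⟨d, tw, ι, hspan, hdim, htw, hinj⟩ := hsop
  haveI := isDomain_of_isRegularLocalRing A
  have hAK : Function.Injective (algebraMap A K) := IsFractionRing.injective A K
  haveI : CharP A p := (algebraMap A K).charP hAK p
  -- the big field and the injectivity of `A → Ω`
  let Ω := AlgebraicClosure K
  have hAΩ : Function.Injective (algebraMap A Ω) := by
    rw [IsScalarTower.algebraMap_eq A K Ω]
    exact (algebraMap K Ω).injective.comp hAK
  -- the charged indices `S` and a charged index `i₀`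
  set S : Finset (Fin (m + 1)) := Finset.univ.filter fun i => t i ∈ maximalIdeal A with hS
  have hmemS : ∀ i, i ∈ S ↔ t i ∈ maximalIdeal A := fun i => by simp [hS]
  obtain ⟨i₀, hi₀⟩ := hSne
  have hi₀S : i₀ ∈ S := (hmemS i₀).mpr hi₀
  -- the unit part `u` of `g`
  have hu : IsUnit (∏ i ∈ Sᶜ, t i ^ a i) := by
    refine IsUnit.prod_iff.mpr fun i hi => IsUnit.pow _ ?_
    exact IsLocalRing.notMem_maximalIdeal.mp fun h => Finset.mem_compl.mp hi ((hmemS i).mpr h)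
  obtain ⟨u, hu_val⟩ : ∃ u : Aˣ, (u : A) = ∏ i ∈ Sᶜ, t i ^ a i := hu
  have hg : ∏ i, t i ^ a i = (∏ i ∈ S, t i ^ a i) * u := by
    rw [hu_val, Finset.prod_mul_prod_compl]
  -- Bezout: `a i₀ * b = p * c' + 1`
  obtain ⟨b, -, hb⟩ := Nat.exists_mul_mod_eq_one_of_coprime
    (Nat.coprime_comm.mp ((Nat.Prime.coprime_iff_not_dvd hp).mpr (ha i₀))) hp.one_lt
  obtain ⟨c', hbc⟩ : ∃ c', a i₀ * b = p * c' + 1 :=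
    ⟨a i₀ * b / p, by have := Nat.div_add_mod (a i₀ * b) p; omega⟩
  -- absorb the unit: twist the generator `tw (ι i₀) = t i₀` by `W = u ^ b`
  set W : Aˣ := u ^ b with hW
  set tw' : Fin d → A := Function.update tw (ι i₀) (tw (ι i₀) * (W : A)) with htw'
  have hspan' : Ideal.span (Set.range tw') = maximalIdeal A := by
    rw [← hspan]
    exact span_range_update_mul_unit tw (ι i₀) W
  -- enumerate the charged indices
  set s := S.card with hs
  set enum : Fin s ≃ {i // i ∈ S} := S.equivFin.symm with henum
  have henS : ∀ k, t (enum k) ∈ maximalIdeal A := fun k => (hmemS _).mp (enum k).2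
  set ι' : Fin s → Fin d := fun k => ι (enum k) with hι'
  have hinjι' : Function.Injective ι' := fun k k' h =>
    enum.injective (Subtype.ext (hinj _ _ (henS k) (henS k') h))
  have htwι : ∀ k,
      tw' (ι' k) = t (enum k) * if (enum k : Fin (m + 1)) = i₀ then (W : A) else 1 := by
    intro k
    by_cases hk : (enum k : Fin (m + 1)) = i₀
    · rw [if_pos hk]
      show Function.update tw (ι i₀) (tw (ι i₀) * (W : A)) (ι (enum k)) = _
      rw [hk, Function.update_self, htw i₀ hi₀]
    · rw [if_neg hk, mul_one]
      have hne : ι (enum k) ≠ ι i₀ := fun h => hk (hinj _ _ (henS k) hi₀ h)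
      show Function.update tw (ι i₀) (tw (ι i₀) * (W : A)) (ι (enum k)) = _
      rw [Function.update_of_ne hne, htw _ (henS k)]
  have hI0 : ∀ f : Fin (m + 1) → ℕ,
      ∏ k, tw' (ι' k) ^ f (enum k) = (∏ i ∈ S, t i ^ f i) * (W : A) ^ f i₀ :=
    prod_pow_twist_reindex t S enum i₀ hi₀S W (fun k => tw' (ι' k)) htwι
  -- `p`-th roots of the (twisted) charged parameters and the root overring
  have hroot : ∀ k : Fin s, ∃ τk : Ω, τk ^ p = algebraMap A Ω (tw' (ι' k)) := fun k =>
    IsAlgClosed.exists_pow_nat_eq _ hp.pos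
  choose τ hτ using hroot
  obtain ⟨-, hIC, -, hspanM⟩ := hRO hAΩ p hp s d tw' hspan' hdim ι' hinjι' τ hτ
  have hPI' := hPI p hp s d tw' hspan' hdim ι' hinjι'
  -- the exponent vectors `j ↦ (j a_i mod p)_{i ∈ S}` are pairwise distinct (look at `i₀`)
  have hn : ∀ j j' : Fin p,
      (∀ k, (j : ℕ) * a (enum k) % p = (j' : ℕ) * a (enum k) % p) → j = j' := by
    intro j j' h
    have hk₀ : (j : ℕ) * a i₀ % p = (j' : ℕ) * a i₀ % p := by
      simpa [henum] using h (enum.symm ⟨i₀, hi₀S⟩)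
    have key : ∀ i : ℕ, i * a i₀ * b % p = i % p := fun i => by
      rw [mul_assoc, hbc, show i * (p * c' + 1) = i + p * (i * c') by ring,
        Nat.add_mul_mod_self_left]
    have h3 : (j : ℕ) % p = (j' : ℕ) % p := by
      have := Nat.ModEq.mul_right b hk₀
      unfold Nat.ModEq at this
      rwa [key, key] at this
    exact Fin.ext (by rwa [Nat.mod_eq_of_lt j.2, Nat.mod_eq_of_lt j'.2] at h3)
  -- `g^j · u^{p c' j} = ∏_k tw'(ι' k)^{j a_k}`
  have hprod1 : ∀ j : ℕ, (↑(u⁻¹) : A) ^ (c' * j * p) *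
      ∏ k, tw' (ι' k) ^ (j * a (enum k)) = (∏ i, t i ^ a i) ^ j := by
    intro j
    rw [hI0 (fun i => j * a i)]
    have h1 : ∏ i ∈ S, t i ^ (j * a i) = (∏ i ∈ S, t i ^ a i) ^ j := by
      rw [← Finset.prod_pow]
      refine Finset.prod_congr rfl fun i _ => ?_
      rw [← pow_mul, mul_comm]
    have h2 : (W : A) ^ (j * a i₀) = (u : A) ^ (c' * j * p) * (u : A) ^ j := by
      rw [hW, Units.val_pow_eq_pow_val, ← pow_mul, ← pow_add]
      congr 1
      calc b * (j * a i₀) = j * (a i₀ * b) := by ring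
        _ = j * (p * c' + 1) := by rw [hbc]
        _ = c' * j * p + j := by ring
    have h3 : (↑(u⁻¹) : A) ^ (c' * j * p) * (u : A) ^ (c' * j * p) = 1 := by
      rw [← mul_pow, Units.inv_mul, one_pow]
    rw [h1, h2, hg]
    calc _ = ((↑(u⁻¹) : A) ^ (c' * j * p) * (u : A) ^ (c' * j * p)) *
        ((∏ i ∈ S, t i ^ a i) ^ j * (u : A) ^ j) := by ring
      _ = _ := by rw [h3, one_mul, mul_pow]
  -- the twisted coefficients
  set κ' : Fin p → K := fun j => κ j * algebraMap A K ((↑(u⁻¹) : A) ^ (c' * (j : ℕ)))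
    with hκ'_def
  have hκ' : ∑ j, κ' j ^ p * algebraMap A K (∏ k, tw' (ι' k) ^ ((j : ℕ) * a (enum k))) ∈
      (algebraMap A K).range := by
    have heq : ∀ j : Fin p,
        κ' j ^ p * algebraMap A K (∏ k, tw' (ι' k) ^ ((j : ℕ) * a (enum k))) =
          κ j ^ p * algebraMap A K (∏ i, t i ^ a i) ^ (j : ℕ) := by
      intro j
      rw [← map_pow, ← hprod1 j, hκ'_def]
      simp only [map_mul, map_pow]
      ring
    rw [Finset.sum_congr rfl fun j _ => heq j]
    exact hκ
  have hcore := kummerDescent_of_rootOverring (K := K) p hp (fun k => tw' (ι' k)) τ hτ hPI' hIC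
    hspanM (fun j k => (j : ℕ) * a (enum k)) hn κ' hκ'
  -- untwist
  intro j
  have hj := hcore j
  rw [hI0 (fun i => (j : ℕ) * a i / p)] at hj
  have hA : (u : A) ^ (c' * j) * (∏ i ∈ Sᶜ, t i ^ ((j : ℕ) * a i / p)) *
      (↑(W⁻¹) : A) ^ ((j : ℕ) * a i₀ / p) * ((↑(u⁻¹) : A) ^ (c' * j) *
        ((∏ i ∈ S, t i ^ ((j : ℕ) * a i / p)) * (W : A) ^ ((j : ℕ) * a i₀ / p))) =
      (∏ i ∈ S, t i ^ ((j : ℕ) * a i / p)) * ∏ i ∈ Sᶜ, t i ^ ((j : ℕ) * a i / p) := by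
    have h1 : (u : A) ^ (c' * j) * (↑(u⁻¹) : A) ^ (c' * j) = 1 := by
      rw [← mul_pow, Units.mul_inv, one_pow]
    have h2 :
        (↑(W⁻¹) : A) ^ ((j : ℕ) * a i₀ / p) * (W : A) ^ ((j : ℕ) * a i₀ / p) = 1 := by
      rw [← mul_pow, Units.inv_mul, one_pow]
    calc _ = ((u : A) ^ (c' * j) * (↑(u⁻¹) : A) ^ (c' * j)) *
          ((↑(W⁻¹) : A) ^ ((j : ℕ) * a i₀ / p) * (W : A) ^ ((j : ℕ) * a i₀ / p)) *
          ((∏ i ∈ S, t i ^ ((j : ℕ) * a i / p)) *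
            ∏ i ∈ Sᶜ, t i ^ ((j : ℕ) * a i / p)) := by
          ring
      _ = _ := by rw [h1, h2, one_mul, one_mul]
  have heq : κ j * algebraMap A K (∏ i, t i ^ ((j : ℕ) * a i / p)) =
      algebraMap A K ((u : A) ^ (c' * j) * (∏ i ∈ Sᶜ, t i ^ ((j : ℕ) * a i / p)) *
        (↑(W⁻¹) : A) ^ ((j : ℕ) * a i₀ / p)) *
      (κ' j * algebraMap A K
        ((∏ i ∈ S, t i ^ ((j : ℕ) * a i / p)) * (W : A) ^ ((j : ℕ) * a i₀ / p))) := by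
    rw [← Finset.prod_mul_prod_compl S (fun i => t i ^ ((j : ℕ) * a i / p)), ← hA, hκ'_def]
    simp only [map_mul]
    ring
  rw [heq]
  exact Subring.mul_mem _ (RingHom.mem_range_self _ _) hj

end Summit.ResolutionOfSingularities.ResolutionOfSingularities.Theorems.RadicialJung.CleanModelsSuffice

end
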